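import Literature.MathematicalPhysics.PowerSystems.ClassicalSwingLossyExponentialStability
import Literature.LinearAlgebra.Matrix.SecondOrderDampedTypeCount
import HarnessLib

/-!
# The TYPE of a rest point of the classical model WITH TRANSFER CONDUCTANCES, certificate form:
# a Lyapunov certificate `P` for the reference-frame Jacobian fixes the number of right-half-plane
# eigenvalues of the lossy swing Jacobian (main inertia theorem), the rotation split off

Topic `Literature/MathematicalPhysics/PowerSystems`, namespace
`Literature.MathematicalPhysics.PowerSystems.InternalNode` (the Kron-reduced classical model
`InternalNode`, `ClassicalSwingModel.lean`; its lossy linearisation `lossyWeight`, `swingJacG` of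
`ClassicalSwingLossyExponentialStability.lean` — used UNCHANGED). Companion of
`ClassicalSwingTypeCount.lean` (the LOSSLESS type count `countP_roots_charpoly_swingJac`: type `k` ⇔
index `k` of the reduced Hessian) for the case the source treats last: «Step 4» of the proof of
Theorem 6.1, the system WITH transfer conductances, where the stiffness block
`K(δ)ᵢⱼ = δᵢⱼΣₖwᵢₖ − wᵢⱼ`, `wᵢⱼ = EᵢEⱼ(Bᵢⱼcos δᵢⱼ − Gᵢⱼ sin δᵢⱼ)`, is NO LONGER SYMMETRIC and no energy
function exists. The printed route is perturbative (small conductances, no eigenvalue crosses the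
axis); the tree's route here is a CERTIFICATE: a real symmetric `P` with `J_refᵀP + PJ_ref ≺ 0` for the
reference-frame Jacobian `J_ref` fixes `In(J_ref) = In(−P)` by the main inertia theorem
(Carlson–Schneider; `Literature/LinearAlgebra/Matrix/SecondOrderDampedTypeCount.lean` §5,
`countP_roots_charpoly_secondOrderJac_of_lyapunovCert`), for ANY conductances. Everything is PROVED;
two definitions with bodies (`lossyStiff`, `relJacG`); no named fact.

SOURCES (read on the page). H.-D. Chiang, in *Systems and Control Theory for Power Systems*, IMA 64
(Springer 1995) [Chiang1995] (`lit galaxy read panama:460265875308562`): §2 p0046 L13 (hyperbolic /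
type-k); §6.1 p0065 L3 («not a minimal realization … By using one machine as reference»); §6.3 Thm 6.1
p0068 and its Step 4 (p0069–p0070: the system with transfer conductances (6.8), continuity of the
eigenvalues). D. Carlson, H. Schneider, J. Math. Anal. Appl. 6 (1963) [CarlsonSchneider1962] §1 (main
inertia theorem «if `AH + HA* > 0` then `In A = In H`»), as PROVED in the tree
(`LyapunovEquation.inertia_eq_of_lyapunov_posDef`). P. W. Sauer, M. A. Pai, *Power System Dynamics and
Stability* (1998) [SauerPai1998] §9.4 (9.17)–(9.18) (the linearised multimachine model).

## What is proved (`d : InternalNode m`, angles `δ`, reference machine `i₀`)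

* `lossyStiff δ` (**definition**: `K(δ)`), `swingJacG_eq_secondOrderJac`
  (`swingJacG δ = [[0, I], [−M⁻¹K(δ), −M⁻¹D]]`), `sum_lossyStiff_row` (`K(δ)𝟙 = 0`: rotational
  invariance survives the conductances), `relJacG δ i₀` (**definition**: the reference-frame Jacobian on
  the `2m − 1` states `((δ_k − δ_{i₀})_{k ≠ i₀}, ω)`), **`charpoly_swingJacG_eq_X_mul`**
  (`χ_J(X) = X·χ_{J_ref}(X)`).
* **`countP_roots_charpoly_swingJacG_of_lyapunovCert`**: `P` real symmetric with `uᵀP(J_ref u) < 0` for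
  `u ≠ 0` ⇒ `#{Re > 0} = #{λ_k(P) < 0}`, `#{Re < 0} = #{λ_k(P) > 0}`, `#{Re = 0} = 1` (the rotation) for
  the characteristic roots of `swingJacG δ`, with multiplicity; `typeOne_lossy_of_lyapunovCert`
  (one negative eigenvalue of `P` ⇒ type one modulo the rotation);
  `hyperbolicSink_lossy_of_lyapunovCert` (`P ≻ 0` ⇒ no root in `Re ≥ 0` but the simple rotation — the
  spectral sentence behind `syncEquilibrium_locally_expStable_lossy_of_lyapunovCertificate`).

THREE COLUMNS. Statements about the LINEARISATION MATRIX of MODEL «classical network-reduced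
multimachine model with transfer conductances» at a rest point; for a kernel instance: `P` = a
rational rounding of a floating-point solution of `J_refᵀP + PJ_ref = −Q`, then TWO exact `LDLᵀ`
factorizations (`SylvesterInertiaCertificate.card_eigenvalues_lt_eq_card_neg` for the inertia of `P`;
all-positive pivots of `−(J_refᵀP + PJ_ref)` for `hneg`; with interval line data, the margin absorbs
the deviation via `EigenvalueCountCertificates.abs_dotProduct_mulVec_le_of_abs_le_rowSum`). Nothing is
said about any grid; «type» is a property of a rest point of the MODEL.

## Mathlib / tree search
`rg "lossy|transfer conductance" Literature/MathematicalPhysics/PowerSystems`: the lossy files give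
exponential STABILITY certificates (`ClassicalSwingLossyExponentialStability`, Lur'e–Postnikov files)
— no type / inertia statement before this file. Used: `secondOrderJac`, `refSecondOrderJac`,
`charpoly_secondOrderJac_eq_X_mul`, `countP_roots_charpoly_secondOrderJac_of_lyapunovCert` (tree).

## References
* [Chiang1995] H.-D. Chiang, in: Systems and Control Theory for Power Systems, IMA 64, Springer 1995,
  §2 (p. 46), §6.1, §6.3 Thm 6.1 (Step 4).
* [CarlsonSchneider1962] D. Carlson, H. Schneider, Inertia theorems for matrices: the semidefinite
  case, J. Math. Anal. Appl. 6 (1963) 430–446, §1.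
* [SauerPai1998] P. W. Sauer, M. A. Pai, Power System Dynamics and Stability, Prentice Hall 1998, §9.4.

AI-produced formalisation (LADDER-GRIDFUSION seat gridfusion-lit-2 g10, 2026-08-28).
-/

set_option autoImplicit false

noncomputable section

open Set Finset Matrix Polynomial
open scoped Matrix BigOperators
open Literature.LinearAlgebra.Matrix

namespace Literature.MathematicalPhysics.PowerSystems

namespace InternalNode

variable {m : ℕ} (d : InternalNode m)

/-- **The lossy stiffness matrix** `K(δ)ᵢⱼ = δᵢⱼ Σₖ wᵢₖ(δ) − wᵢⱼ(δ)` (the Jacobian `∂P_e/∂δ` of the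
electrical powers with transfer conductances; not symmetric).
[cite: SauerPai1998, §9.4 eqs. (9.17)–(9.18); Chiang1995, §6.3 system (6.8)] -/
def lossyStiff (δs : Fin m → ℝ) : Matrix (Fin m) (Fin m) ℝ := fun i j =>
  (if i = j then ∑ k, d.lossyWeight δs i k else 0) - d.lossyWeight δs i j

/-- The lossy swing Jacobian is the damped second-order Jacobian of the lossy stiffness:
`swingJacG δ = [[0, I], [−M⁻¹K(δ), −M⁻¹diag(D)]]`. [cite: SauerPai1998, §9.4 eqs. (9.17)–(9.18)] -/
theorem swingJacG_eq_secondOrderJac (δs : Fin m → ℝ) :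
    d.swingJacG δs = secondOrderJac (d.lossyStiff δs) d.M d.D := rfl

/-- **Zero row sums of the lossy stiffness** (`K(δ)𝟙 = 0`: shifting all angles changes no power, with
or without conductances). [cite: Chiang1995, §6.1 («not a minimal realization»)] -/
theorem sum_lossyStiff_row (δs : Fin m → ℝ) (i : Fin m) : ∑ j, d.lossyStiff δs i j = 0 := by
  simp only [lossyStiff, Finset.sum_sub_distrib, Finset.sum_ite_eq, Finset.mem_univ, if_true, sub_self]

/-- **The reference-frame Jacobian of the lossy model** on the `2m − 1` states
`((δ_k − δ_{i₀})_{k ≠ i₀}, ω)`. [cite: Chiang1995, §6.1 eq. (6.2), §6.3 system (6.8)] -/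
def relJacG (δs : Fin m → ℝ) (i₀ : Fin m) :
    Matrix ({k : Fin m // k ≠ i₀} ⊕ Fin m) ({k : Fin m // k ≠ i₀} ⊕ Fin m) ℝ :=
  refSecondOrderJac (d.lossyStiff δs) d.M d.D i₀

/-- **`χ_J(X) = X · χ_{J_ref}(X)`** for the lossy Jacobian: the rotation mode splits off.
[cite: Chiang1995, §6.1 (p0065 L3) with eq. (6.2)] -/
theorem charpoly_swingJacG_eq_X_mul (δs : Fin m → ℝ) (i₀ : Fin m) :
    (d.swingJacG δs).charpoly = X * (d.relJacG δs i₀).charpoly := by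
  rw [swingJacG_eq_secondOrderJac, relJacG]
  exact charpoly_secondOrderJac_eq_X_mul (d.sum_lossyStiff_row δs) d.M d.D i₀

/-- **THE TYPE OF A REST POINT OF THE LOSSY CLASSICAL MODEL, CERTIFICATE FORM.** For `d : InternalNode m`
(any inertias, dampings, susceptances AND conductances), an angle vector `δ`, a reference machine `i₀`
and a real symmetric `P` on the reference coordinates with `uᵀP(J_ref u) < 0` for every `u ≠ 0`
(`J_ref = relJacG δ i₀`): the characteristic polynomial of the swing Jacobian `swingJacG δ` has exactly
`#{negative eigenvalues of P}` roots with positive real part, `#{positive eigenvalues of P}` with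
negative real part, and exactly ONE on the imaginary axis (the rotation `0`), counted with
multiplicity. [cite: Chiang1995, §6.3 Theorem 6.1 Step 4 with §6.1, §2 (p. 46: type-k); CarlsonSchneider1962, §1 Main Inertia Theorem] -/
theorem countP_roots_charpoly_swingJacG_of_lyapunovCert (δs : Fin m → ℝ) (i₀ : Fin m)
    {P : Matrix ({k : Fin m // k ≠ i₀} ⊕ Fin m) ({k : Fin m // k ≠ i₀} ⊕ Fin m) ℝ} (hP : P.IsHermitian)
    (hneg : ∀ u : {k : Fin m // k ≠ i₀} ⊕ Fin m → ℝ, u ≠ 0 → u ⬝ᵥ (P *ᵥ (d.relJacG δs i₀ *ᵥ u)) < 0) :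
    ((d.swingJacG δs).map (algebraMap ℝ ℂ)).charpoly.roots.countP (fun μ => 0 < μ.re)
        = #{k | hP.eigenvalues k < 0} ∧
      ((d.swingJacG δs).map (algebraMap ℝ ℂ)).charpoly.roots.countP (fun μ => μ.re < 0)
        = #{k | 0 < hP.eigenvalues k} ∧
      ((d.swingJacG δs).map (algebraMap ℝ ℂ)).charpoly.roots.countP (fun μ => μ.re = 0) = 1 := by
  rw [swingJacG_eq_secondOrderJac]
  exact countP_roots_charpoly_secondOrderJac_of_lyapunovCert (d.sum_lossyStiff_row δs) d.M d.D i₀ hP hneg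

/-- **Type one, lossy model**: a certificate `P` with exactly one negative eigenvalue ⇒ exactly one
characteristic root in `Re > 0` and the simple rotation root on the axis — the controlling /
closest u.e.p. property WITH transfer conductances. [cite: Chiang1995, §6.3 Theorem 6.1 Step 4, §5 («type-one equilibrium point»)] -/
theorem typeOne_lossy_of_lyapunovCert (δs : Fin m → ℝ) (i₀ : Fin m)
    {P : Matrix ({k : Fin m // k ≠ i₀} ⊕ Fin m) ({k : Fin m // k ≠ i₀} ⊕ Fin m) ℝ} (hP : P.IsHermitian)
    (hneg : ∀ u : {k : Fin m // k ≠ i₀} ⊕ Fin m → ℝ, u ≠ 0 → u ⬝ᵥ (P *ᵥ (d.relJacG δs i₀ *ᵥ u)) < 0)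
    (hone : #{k | hP.eigenvalues k < 0} = 1) :
    ((d.swingJacG δs).map (algebraMap ℝ ℂ)).charpoly.roots.countP (fun μ => 0 < μ.re) = 1 ∧
      ((d.swingJacG δs).map (algebraMap ℝ ℂ)).charpoly.roots.countP (fun μ => μ.re = 0) = 1 := by
  obtain ⟨h1, -, h3⟩ := d.countP_roots_charpoly_swingJacG_of_lyapunovCert δs i₀ hP hneg
  exact ⟨h1.trans hone, h3⟩

/-- **Hyperbolic sink modulo the rotation, lossy model**: a POSITIVE DEFINITE certificate `P`
(`uᵀPu > 0`, `u ≠ 0`) ⇒ no characteristic root with `Re > 0`, `2m − 1` roots with `Re < 0`, and the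
simple rotation root — the spectral sentence of the lossy exponential-stability certificates.
[cite: Chiang1995, §2 (p. 46), §6.3 Theorem 6.1 Step 4; Khalil2002, Theorem 4.6] -/
theorem hyperbolicSink_lossy_of_lyapunovCert (δs : Fin m → ℝ) (i₀ : Fin m)
    {P : Matrix ({k : Fin m // k ≠ i₀} ⊕ Fin m) ({k : Fin m // k ≠ i₀} ⊕ Fin m) ℝ} (hP : P.IsHermitian)
    (hPpos : ∀ u : {k : Fin m // k ≠ i₀} ⊕ Fin m → ℝ, u ≠ 0 → 0 < u ⬝ᵥ (P *ᵥ u))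
    (hneg : ∀ u : {k : Fin m // k ≠ i₀} ⊕ Fin m → ℝ, u ≠ 0 → u ⬝ᵥ (P *ᵥ (d.relJacG δs i₀ *ᵥ u)) < 0) :
    ((d.swingJacG δs).map (algebraMap ℝ ℂ)).charpoly.roots.countP (fun μ => 0 < μ.re) = 0 ∧
      ((d.swingJacG δs).map (algebraMap ℝ ℂ)).charpoly.roots.countP (fun μ => μ.re < 0) = 2 * m - 1 ∧
      ((d.swingJacG δs).map (algebraMap ℝ ℂ)).charpoly.roots.countP (fun μ => μ.re = 0) = 1 := by
  obtain ⟨h1, h2, h3⟩ := d.countP_roots_charpoly_swingJacG_of_lyapunovCert δs i₀ hP hneg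
  have hPD : P.PosDef :=
    Matrix.PosDef.of_dotProduct_mulVec_pos hP fun x hx => by rw [star_trivial]; exact hPpos x hx
  have hev : ∀ k, 0 < hP.eigenvalues k := hPD.eigenvalues_pos
  have hnegc : #{k | hP.eigenvalues k < 0} = 0 := by
    rw [Finset.card_eq_zero, Finset.filter_eq_empty_iff]
    exact fun k _ => not_lt.2 (hev k).le
  have hposc : #{k | 0 < hP.eigenvalues k} = 2 * m - 1 := by
    rw [Finset.filter_true_of_mem fun k _ => hev k, Finset.card_univ, Fintype.card_sum,
      Fintype.card_fin, Fintype.card_subtype_compl, Fintype.card_fin, Fintype.card_unique]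
    omega
  exact ⟨h1.trans hnegc, h2.trans hposc, h3⟩

end InternalNode

end Literature.MathematicalPhysics.PowerSystems

end
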